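import Literature.Analysis.FluidPDE.LuoTitiPerturbation
import Literature.Analysis.FluidPDE.JetStressEstimates
import Literature.Analysis.FluidPDE.FracLaplacianSpaceTime
import HarnessLib

/-!
# Luo–Titi's perturbation: `L²`/`L¹` sizes of the increment and `L¹` size of the new stress
  (Luo–Titi 2020, §3.4–§3.5)

Analysis/FluidPDE support file (everything proved; no named facts) for the proof of the Iteration
Lemma of T. Luo and E. S. Titi, Calc. Var. PDE 59 (2020) = arXiv:1808.07595
(`Torus.LuoTiti2020_iterationLemma`): the sizes, at a fixed time of the slab, of the cut-off
perturbation `w = ψ•wpc + ψ²•wt` (`LuoTitiPerturbation`) and of the new Reynolds stress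
`newStress = S_ψ + v ⊗ w + w ⊗ v + ℛ(f_ψ + ν(-Δ)^θ wloc)` (`LuoTitiPerturbationFracNSR`), from the
sizes of the pieces of the tree's intermittent-jet step (`JetVelocityEstimates`,
`JetStressEstimates`) — mirroring `JetStep.Datum.integral_norm_newStress_le` (the assembly of
Buckmaster–Vicol §7.6) with the cut-off weights `0 ≤ ψ ≤ 1`, `|ψ′| ≤ Ψ₁` and the hyperviscous
term entering as the size `Hν` (`LuoTitiHyperviscous`):

* `Setup.integral_norm_w_le` — `∫‖w(t)‖ ≤ L_p + L_c + √E_X + √E_ζ` ((3.15): `‖w‖_{L¹} ≲ δ^{1/2} r^{3/2-3/p}`-type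
  smallness through the `L¹` smallness of the intermittent principal part);
* `Setup.eLpNorm_w_le` — `‖w(t)‖_{L²} ≤ √E_p + √E_r` ((3.14): `‖w‖_{L²} ≤ (M/2) δ^{1/2}` + small);
* **`Setup.integral_norm_newStress_le`** — the `L¹` size of the new stress at time `t` ((3.18)–(3.21)).

## References

* T. Luo, E. S. Titi, Calc. Var. PDE 59 (2020) = arXiv:1808.07595, §3.4 (3.14)–(3.15), §3.5
  (3.17)–(3.21). [`LuoTiti2020`]
* T. Buckmaster, V. Vicol, EMS Surv. Math. Sci. 6 (2019) = arXiv:1901.09023, §7.6. [`BuckmasterVicol2020`]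
-/

noncomputable section

open MeasureTheory Set Filter Topology Function UnitAddTorus
open scoped InnerProductSpace ContDiff ENNReal NNReal

namespace Literature.Analysis.FluidPDE

namespace LuoTiti

open Literature.Analysis.FunctionSpaces FunctionSpaces.Torus Mikado NashGeometric Jet JetStep

local notation "𝕋³" => UnitAddTorus (Fin 3)
local notation "E³" => EuclideanSpace ℝ (Fin 3)
local notation "Idx" => Index (Fin 3)

namespace Setup

variable {S : Setup} (h : S.Valid)
include h

/-! ## The increment -/

/-- Pointwise: `‖w‖ ≤ ‖wp‖ + ‖wpc - wp‖ + ‖X‖ + ‖∇ζ‖` (`0 ≤ ψ ≤ 1`). [folklore] -/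
theorem norm_w_le_pieces (t : ℝ) (y : 𝕋³) :
    ‖S.w t y‖ ≤ ‖S.D.wp t y‖ + ‖S.D.wpc t y - S.D.wp t y‖ + ‖S.D.X t y‖ + ‖Torus.gradient (S.D.zeta t) y‖ := by
  obtain ⟨hψ0, hψ1⟩ := h.hψ01 t
  have e : S.w t y = S.ψ t • (S.D.wp t y + (S.D.wpc t y - S.D.wp t y)) + (S.ψ t) ^ 2 • (S.D.X t y + Torus.gradient (S.D.zeta t) y) := by
    simp only [w, wt, add_sub_cancel]
  rw [e]
  have hψ2 : (S.ψ t) ^ 2 ≤ 1 := by nlinarith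
  calc ‖S.ψ t • (S.D.wp t y + (S.D.wpc t y - S.D.wp t y)) + (S.ψ t) ^ 2 • (S.D.X t y + Torus.gradient (S.D.zeta t) y)‖
      ≤ ‖S.ψ t • (S.D.wp t y + (S.D.wpc t y - S.D.wp t y))‖ + ‖(S.ψ t) ^ 2 • (S.D.X t y + Torus.gradient (S.D.zeta t) y)‖ := norm_add_le _ _
    _ = S.ψ t * ‖S.D.wp t y + (S.D.wpc t y - S.D.wp t y)‖ + (S.ψ t) ^ 2 * ‖S.D.X t y + Torus.gradient (S.D.zeta t) y‖ := by
        rw [norm_smul, norm_smul, Real.norm_of_nonneg hψ0, Real.norm_of_nonneg (sq_nonneg _)]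
    _ ≤ 1 * (‖S.D.wp t y‖ + ‖S.D.wpc t y - S.D.wp t y‖) + 1 * (‖S.D.X t y‖ + ‖Torus.gradient (S.D.zeta t) y‖) :=
        add_le_add (mul_le_mul hψ1 (norm_add_le _ _) (norm_nonneg _) zero_le_one)
          (mul_le_mul hψ2 (norm_add_le _ _) (norm_nonneg _) zero_le_one)
    _ = _ := by ring

/-- **`∫‖w(t)‖ ≤ L_p + L_c + √E_X + √E_ζ`.** [cite: LuoTiti2020, §3.4 (3.15)] -/
theorem integral_norm_w_le {t : ℝ} (ht : t ∈ Icc 0 S.D.T) {Lp Lc EX Eζ : ℝ}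
    (hLp : ∫ y, ‖S.D.wp t y‖ ≤ Lp) (hLc : ∫ y, ‖S.D.wpc t y - S.D.wp t y‖ ≤ Lc)
    (hEX : ∫ y, ‖S.D.X t y‖ ^ 2 ≤ EX) (hEζ : ∫ y, ‖Torus.gradient (S.D.zeta t) y‖ ^ 2 ≤ Eζ) :
    ∫ y, ‖S.w t y‖ ≤ Lp + Lc + Real.sqrt EX + Real.sqrt Eζ := by
  have hD := h.hD
  have hw : Torus.IsSmooth (S.w t) := (smooth_w h).isSmooth_slice (mem_univ t)
  have hwp := Datum.isSmooth_wp hD ht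
  have hwpc : Torus.IsSmooth (S.D.wpc t) := (Datum.smooth_wpc hD).isSmooth_slice ht
  have hX : Torus.IsSmooth (S.D.X t) := (Datum.smooth_X hD).isSmooth_slice ht
  have hζ : Torus.IsSmooth (Torus.gradient (S.D.zeta t)) := ((Datum.smooth_zeta hD).isSmooth_slice ht).gradient
  have c1 : Continuous fun y => ‖S.D.wp t y‖ := hwp.continuous.norm
  have c2 : Continuous fun y => ‖S.D.wpc t y - S.D.wp t y‖ := (hwpc.sub hwp).continuous.norm
  have c3 : Continuous fun y => ‖S.D.X t y‖ := hX.continuous.norm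
  have c4 : Continuous fun y => ‖Torus.gradient (S.D.zeta t) y‖ := hζ.continuous.norm
  have j12 : Integrable (fun y => ‖S.D.wp t y‖ + ‖S.D.wpc t y - S.D.wp t y‖) volume := (c1.add c2).integrable_unitAddTorus
  have j123 : Integrable (fun y => ‖S.D.wp t y‖ + ‖S.D.wpc t y - S.D.wp t y‖ + ‖S.D.X t y‖) volume := ((c1.add c2).add c3).integrable_unitAddTorus
  have j1234 : Integrable (fun y => ‖S.D.wp t y‖ + ‖S.D.wpc t y - S.D.wp t y‖ + ‖S.D.X t y‖ + ‖Torus.gradient (S.D.zeta t) y‖) volume :=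
    (((c1.add c2).add c3).add c4).integrable_unitAddTorus
  calc ∫ y, ‖S.w t y‖ ≤ ∫ y, (‖S.D.wp t y‖ + ‖S.D.wpc t y - S.D.wp t y‖ + ‖S.D.X t y‖ + ‖Torus.gradient (S.D.zeta t) y‖) :=
        integral_mono hw.continuous.norm.integrable_unitAddTorus j1234 (norm_w_le_pieces h t)
    _ = (∫ y, ‖S.D.wp t y‖) + (∫ y, ‖S.D.wpc t y - S.D.wp t y‖) + (∫ y, ‖S.D.X t y‖) + ∫ y, ‖Torus.gradient (S.D.zeta t) y‖ := by
        rw [integral_add j123 c4.integrable_unitAddTorus, integral_add j12 c3.integrable_unitAddTorus,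
          integral_add c1.integrable_unitAddTorus c2.integrable_unitAddTorus]
    _ ≤ Lp + Lc + Real.sqrt EX + Real.sqrt Eζ :=
        add_le_add (add_le_add (add_le_add hLp hLc) (integral_norm_le_sqrt hX.continuous hEX)) (integral_norm_le_sqrt hζ.continuous hEζ)

/-- The square-integral of a three-term majorant: `∫(a+b+c)² ≤ 3(∫a² + ∫b² + ∫c²)`-type bound for
`‖wpc - wp‖ + ‖X‖ + ‖∇ζ‖` (`∫‖wc‖² ≤ sup‖wc‖ ∫‖wc‖`). [folklore] -/
theorem integral_rest_sq_le {t : ℝ} (ht : t ∈ Icc 0 S.D.T) {Sc Lc EX Eζ : ℝ} (hSc : ∀ y, ‖S.D.wpc t y - S.D.wp t y‖ ≤ Sc)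
    (hLc : ∫ y, ‖S.D.wpc t y - S.D.wp t y‖ ≤ Lc) (hEX : ∫ y, ‖S.D.X t y‖ ^ 2 ≤ EX)
    (hEζ : ∫ y, ‖Torus.gradient (S.D.zeta t) y‖ ^ 2 ≤ Eζ) :
    ∫ y, (‖S.D.wpc t y - S.D.wp t y‖ + ‖S.D.X t y‖ + ‖Torus.gradient (S.D.zeta t) y‖) ^ 2 ≤ 3 * (Sc * Lc + EX + Eζ) := by
  have hD := h.hD
  have hwp := Datum.isSmooth_wp hD ht
  have hwpc : Torus.IsSmooth (S.D.wpc t) := (Datum.smooth_wpc hD).isSmooth_slice ht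
  have hX : Torus.IsSmooth (S.D.X t) := (Datum.smooth_X hD).isSmooth_slice ht
  have hζ : Torus.IsSmooth (Torus.gradient (S.D.zeta t)) := ((Datum.smooth_zeta hD).isSmooth_slice ht).gradient
  have c1 : Continuous fun y => ‖S.D.wpc t y - S.D.wp t y‖ := (hwpc.sub hwp).continuous.norm
  have c2 : Continuous fun y => ‖S.D.X t y‖ := hX.continuous.norm
  have c3 : Continuous fun y => ‖Torus.gradient (S.D.zeta t) y‖ := hζ.continuous.norm
  have hSc0 : 0 ≤ Sc := (norm_nonneg _).trans (hSc (Classical.arbitrary _))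
  have hpt : ∀ y, (‖S.D.wpc t y - S.D.wp t y‖ + ‖S.D.X t y‖ + ‖Torus.gradient (S.D.zeta t) y‖) ^ 2 ≤
      3 * (Sc * ‖S.D.wpc t y - S.D.wp t y‖ + ‖S.D.X t y‖ ^ 2 + ‖Torus.gradient (S.D.zeta t) y‖ ^ 2) := by
    intro y
    have h1 : ‖S.D.wpc t y - S.D.wp t y‖ ^ 2 ≤ Sc * ‖S.D.wpc t y - S.D.wp t y‖ := by
      rw [sq]; exact mul_le_mul_of_nonneg_right (hSc y) (norm_nonneg _)
    nlinarith [sq_nonneg (‖S.D.wpc t y - S.D.wp t y‖ - ‖S.D.X t y‖), sq_nonneg (‖S.D.X t y‖ - ‖Torus.gradient (S.D.zeta t) y‖),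
      sq_nonneg (‖S.D.wpc t y - S.D.wp t y‖ - ‖Torus.gradient (S.D.zeta t) y‖)]
  have i1 : Integrable (fun y => Sc * ‖S.D.wpc t y - S.D.wp t y‖) volume := (c1.const_mul Sc).integrable_unitAddTorus
  have i2 : Integrable (fun y => ‖S.D.X t y‖ ^ 2) volume := (c2.pow 2).integrable_unitAddTorus
  have i3 : Integrable (fun y => ‖Torus.gradient (S.D.zeta t) y‖ ^ 2) volume := (c3.pow 2).integrable_unitAddTorus
  have i12 : Integrable (fun y => Sc * ‖S.D.wpc t y - S.D.wp t y‖ + ‖S.D.X t y‖ ^ 2) volume := i1.add i2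
  have i123 : Integrable (fun y => Sc * ‖S.D.wpc t y - S.D.wp t y‖ + ‖S.D.X t y‖ ^ 2 + ‖Torus.gradient (S.D.zeta t) y‖ ^ 2) volume := i12.add i3
  calc ∫ y, (‖S.D.wpc t y - S.D.wp t y‖ + ‖S.D.X t y‖ + ‖Torus.gradient (S.D.zeta t) y‖) ^ 2
      ≤ ∫ y, 3 * (Sc * ‖S.D.wpc t y - S.D.wp t y‖ + ‖S.D.X t y‖ ^ 2 + ‖Torus.gradient (S.D.zeta t) y‖ ^ 2) :=
        integral_mono (((c1.add c2).add c3).pow 2).integrable_unitAddTorus (i123.const_mul 3) hpt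
    _ = 3 * (Sc * (∫ y, ‖S.D.wpc t y - S.D.wp t y‖) + (∫ y, ‖S.D.X t y‖ ^ 2) + ∫ y, ‖Torus.gradient (S.D.zeta t) y‖ ^ 2) := by
        rw [integral_const_mul, integral_add i12 i3, integral_add i1 i2, integral_const_mul]
    _ ≤ 3 * (Sc * Lc + EX + Eζ) := by gcongr

/-- **`‖w(t)‖_{L²} ≤ √E_p + √E_r`** with `E_r = 3(S_cL_c + E_X + E_ζ)`. [cite: LuoTiti2020, §3.4 (3.14)] -/
theorem eLpNorm_w_le {t : ℝ} (ht : t ∈ Icc 0 S.D.T) {Ep Sc Lc EX Eζ : ℝ} (hEp : ∫ y, ‖S.D.wp t y‖ ^ 2 ≤ Ep)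
    (hSc : ∀ y, ‖S.D.wpc t y - S.D.wp t y‖ ≤ Sc) (hLc : ∫ y, ‖S.D.wpc t y - S.D.wp t y‖ ≤ Lc)
    (hEX : ∫ y, ‖S.D.X t y‖ ^ 2 ≤ EX) (hEζ : ∫ y, ‖Torus.gradient (S.D.zeta t) y‖ ^ 2 ≤ Eζ) :
    eLpNorm (S.w t) 2 volume ≤ ENNReal.ofReal (Real.sqrt Ep + Real.sqrt (3 * (Sc * Lc + EX + Eζ))) := by
  have hD := h.hD
  obtain ⟨hψ0, hψ1⟩ := h.hψ01 t
  have hψ2 : (S.ψ t) ^ 2 ≤ 1 := by nlinarith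
  have hwp := Datum.isSmooth_wp hD ht
  have hwpc : Torus.IsSmooth (S.D.wpc t) := (Datum.smooth_wpc hD).isSmooth_slice ht
  have hX : Torus.IsSmooth (S.D.X t) := (Datum.smooth_X hD).isSmooth_slice ht
  have hζ : Torus.IsSmooth (Torus.gradient (S.D.zeta t)) := ((Datum.smooth_zeta hD).isSmooth_slice ht).gradient
  -- `w = ψ wp + rest`
  set rest : 𝕋³ → E³ := fun y => S.ψ t • (S.D.wpc t y - S.D.wp t y) + (S.ψ t) ^ 2 • (S.D.X t y + Torus.gradient (S.D.zeta t) y) with hrest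
  have hrest_s : Torus.IsSmooth rest := ((hwpc.sub hwp).smul _).add ((hX.add hζ).smul _)
  have e : S.w t = fun y => S.ψ t • S.D.wp t y + rest y := by
    funext y; simp only [hrest, w, wt, smul_sub, smul_add]; abel
  have hrest_pt : ∀ y, ‖rest y‖ ≤ ‖S.D.wpc t y - S.D.wp t y‖ + ‖S.D.X t y‖ + ‖Torus.gradient (S.D.zeta t) y‖ := by
    intro y
    calc ‖rest y‖ ≤ ‖S.ψ t • (S.D.wpc t y - S.D.wp t y)‖ + ‖(S.ψ t) ^ 2 • (S.D.X t y + Torus.gradient (S.D.zeta t) y)‖ := norm_add_le _ _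
      _ = S.ψ t * ‖S.D.wpc t y - S.D.wp t y‖ + (S.ψ t) ^ 2 * ‖S.D.X t y + Torus.gradient (S.D.zeta t) y‖ := by
          rw [norm_smul, norm_smul, Real.norm_of_nonneg hψ0, Real.norm_of_nonneg (sq_nonneg _)]
      _ ≤ 1 * ‖S.D.wpc t y - S.D.wp t y‖ + 1 * (‖S.D.X t y‖ + ‖Torus.gradient (S.D.zeta t) y‖) :=
          add_le_add (mul_le_mul hψ1 le_rfl (norm_nonneg _) zero_le_one) (mul_le_mul hψ2 (norm_add_le _ _) (norm_nonneg _) zero_le_one)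
      _ = _ := by ring
  have hEr : ∫ y, ‖rest y‖ ^ 2 ≤ 3 * (Sc * Lc + EX + Eζ) := by
    refine le_trans ?_ (integral_rest_sq_le h ht hSc hLc hEX hEζ)
    have c0 : Continuous fun y => ‖S.D.wpc t y - S.D.wp t y‖ + ‖S.D.X t y‖ + ‖Torus.gradient (S.D.zeta t) y‖ :=
      ((hwpc.sub hwp).continuous.norm.add hX.continuous.norm).add hζ.continuous.norm
    exact integral_mono (hrest_s.continuous.norm.pow 2).integrable_unitAddTorus (c0.pow 2).integrable_unitAddTorus fun y =>
      pow_le_pow_left₀ (norm_nonneg _) (hrest_pt y) 2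
  have hEp' : ∫ y, ‖S.ψ t • S.D.wp t y‖ ^ 2 ≤ Ep := by
    refine le_trans (integral_mono ((hwp.smul _).continuous.norm.pow 2).integrable_unitAddTorus
      (hwp.continuous.norm.pow 2).integrable_unitAddTorus fun y => ?_) hEp
    rw [norm_smul, Real.norm_of_nonneg hψ0]
    exact pow_le_pow_left₀ (by positivity) (by nlinarith [norm_nonneg (S.D.wp t y)]) 2
  rw [e]
  have m1 : AEStronglyMeasurable (fun y => S.ψ t • S.D.wp t y) volume := (hwp.smul _).continuous.aestronglyMeasurable
  have m2 : AEStronglyMeasurable rest volume := hrest_s.continuous.aestronglyMeasurable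
  calc eLpNorm (fun y => S.ψ t • S.D.wp t y + rest y) 2 volume ≤ eLpNorm (fun y => S.ψ t • S.D.wp t y) 2 volume + eLpNorm rest 2 volume :=
        eLpNorm_add_le m1 m2 (by norm_num)
    _ ≤ ENNReal.ofReal (Real.sqrt Ep) + ENNReal.ofReal (Real.sqrt (3 * (Sc * Lc + EX + Eζ))) :=
        add_le_add (Torus.eLpNorm_two_le_ofReal_sqrt (hwp.smul _).continuous hEp') (Torus.eLpNorm_two_le_ofReal_sqrt hrest_s.continuous hEr)
    _ = _ := (ENNReal.ofReal_add (Real.sqrt_nonneg _) (Real.sqrt_nonneg _)).symm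

/-! ## The new stress -/

/-- `∫‖wpc‖² ≤ 2(E_p + S_c L_c)`. [folklore] -/
theorem integral_norm_wpc_sq_le {t : ℝ} (ht : t ∈ Icc 0 S.D.T) {Ep Sc Lc : ℝ} (hEp : ∫ y, ‖S.D.wp t y‖ ^ 2 ≤ Ep)
    (hSc : ∀ y, ‖S.D.wpc t y - S.D.wp t y‖ ≤ Sc) (hLc : ∫ y, ‖S.D.wpc t y - S.D.wp t y‖ ≤ Lc) :
    ∫ y, ‖S.D.wpc t y‖ ^ 2 ≤ 2 * (Ep + Sc * Lc) := by
  have hD := h.hD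
  have hwp := Datum.isSmooth_wp hD ht
  have hwpc : Torus.IsSmooth (S.D.wpc t) := (Datum.smooth_wpc hD).isSmooth_slice ht
  have c1 : Continuous fun y => ‖S.D.wp t y‖ := hwp.continuous.norm
  have c2 : Continuous fun y => ‖S.D.wpc t y - S.D.wp t y‖ := (hwpc.sub hwp).continuous.norm
  have hpt : ∀ y, ‖S.D.wpc t y‖ ^ 2 ≤ 2 * (‖S.D.wp t y‖ ^ 2 + Sc * ‖S.D.wpc t y - S.D.wp t y‖) := by
    intro y
    have h0 : ‖S.D.wpc t y‖ ≤ ‖S.D.wp t y‖ + ‖S.D.wpc t y - S.D.wp t y‖ := by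
      calc ‖S.D.wpc t y‖ = ‖S.D.wp t y + (S.D.wpc t y - S.D.wp t y)‖ := by congr 1; abel
        _ ≤ _ := norm_add_le _ _
    have h1 : ‖S.D.wpc t y - S.D.wp t y‖ ^ 2 ≤ Sc * ‖S.D.wpc t y - S.D.wp t y‖ := by
      rw [sq]; exact mul_le_mul_of_nonneg_right (hSc y) (norm_nonneg _)
    nlinarith [sq_nonneg (‖S.D.wp t y‖ - ‖S.D.wpc t y - S.D.wp t y‖), norm_nonneg (S.D.wpc t y), norm_nonneg (S.D.wp t y),
      norm_nonneg (S.D.wpc t y - S.D.wp t y)]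
  have i1 : Integrable (fun y => ‖S.D.wp t y‖ ^ 2) volume := (c1.pow 2).integrable_unitAddTorus
  have i2 : Integrable (fun y => Sc * ‖S.D.wpc t y - S.D.wp t y‖) volume := (c2.const_mul Sc).integrable_unitAddTorus
  calc ∫ y, ‖S.D.wpc t y‖ ^ 2 ≤ ∫ y, 2 * (‖S.D.wp t y‖ ^ 2 + Sc * ‖S.D.wpc t y - S.D.wp t y‖) :=
        integral_mono (hwpc.continuous.norm.pow 2).integrable_unitAddTorus ((i1.add i2).const_mul 2) hpt
    _ = 2 * ((∫ y, ‖S.D.wp t y‖ ^ 2) + Sc * ∫ y, ‖S.D.wpc t y - S.D.wp t y‖) := by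
        rw [integral_const_mul, integral_add i1 i2, integral_const_mul]
    _ ≤ 2 * (Ep + Sc * Lc) := by
        have hSc0 : 0 ≤ Sc := (norm_nonneg _).trans (hSc (Classical.arbitrary _))
        gcongr

/-- `∫‖wt‖² ≤ 2(E_X + E_ζ)`. [folklore] -/
theorem integral_norm_wt_sq_le {t : ℝ} (ht : t ∈ Icc 0 S.D.T) {EX Eζ : ℝ} (hEX : ∫ y, ‖S.D.X t y‖ ^ 2 ≤ EX)
    (hEζ : ∫ y, ‖Torus.gradient (S.D.zeta t) y‖ ^ 2 ≤ Eζ) : ∫ y, ‖wt S.D t y‖ ^ 2 ≤ 2 * (EX + Eζ) := by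
  have hD := h.hD
  have hX : Torus.IsSmooth (S.D.X t) := (Datum.smooth_X hD).isSmooth_slice ht
  have hζ : Torus.IsSmooth (Torus.gradient (S.D.zeta t)) := ((Datum.smooth_zeta hD).isSmooth_slice ht).gradient
  have hwt : Torus.IsSmooth (wt S.D t) := (smooth_wt h).isSmooth_slice ht
  have c2 : Continuous fun y => ‖S.D.X t y‖ := hX.continuous.norm
  have c3 : Continuous fun y => ‖Torus.gradient (S.D.zeta t) y‖ := hζ.continuous.norm
  have hpt : ∀ y, ‖wt S.D t y‖ ^ 2 ≤ 2 * (‖S.D.X t y‖ ^ 2 + ‖Torus.gradient (S.D.zeta t) y‖ ^ 2) := by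
    intro y
    have h0 : ‖wt S.D t y‖ ≤ ‖S.D.X t y‖ + ‖Torus.gradient (S.D.zeta t) y‖ := norm_add_le _ _
    nlinarith [sq_nonneg (‖S.D.X t y‖ - ‖Torus.gradient (S.D.zeta t) y‖), norm_nonneg (wt S.D t y), norm_nonneg (S.D.X t y),
      norm_nonneg (Torus.gradient (S.D.zeta t) y)]
  have i2 : Integrable (fun y => ‖S.D.X t y‖ ^ 2) volume := (c2.pow 2).integrable_unitAddTorus
  have i3 : Integrable (fun y => ‖Torus.gradient (S.D.zeta t) y‖ ^ 2) volume := (c3.pow 2).integrable_unitAddTorus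
  calc ∫ y, ‖wt S.D t y‖ ^ 2 ≤ ∫ y, 2 * (‖S.D.X t y‖ ^ 2 + ‖Torus.gradient (S.D.zeta t) y‖ ^ 2) :=
        integral_mono (hwt.continuous.norm.pow 2).integrable_unitAddTorus ((i2.add i3).const_mul 2) hpt
    _ = 2 * ((∫ y, ‖S.D.X t y‖ ^ 2) + ∫ y, ‖Torus.gradient (S.D.zeta t) y‖ ^ 2) := by rw [integral_const_mul, integral_add i2 i3]
    _ ≤ 2 * (EX + Eζ) := by gcongr

/-- **`∫‖S_ψ‖ ≤ (2√E_p√E_r + E_r) + L_S + 2√E_pc√E_wt + E_wt`** (`0 ≤ ψ ≤ 1`). [cite: LuoTiti2020, §3.5 (3.19), (3.21)] -/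
theorem integral_norm_Sψ_le {t : ℝ} (ht : t ∈ Icc 0 S.D.T) {Ep Er LS Epc Ewt : ℝ} (hEp : ∫ y, ‖S.D.wp t y‖ ^ 2 ≤ Ep)
    (hEr : ∫ y, ‖S.D.wr t y‖ ^ 2 ≤ Er) (hS : ∫ y, ‖S.D.Sosc t y‖ ≤ LS) (hEpc : ∫ y, ‖S.D.wpc t y‖ ^ 2 ≤ Epc)
    (hEwt : ∫ y, ‖wt S.D t y‖ ^ 2 ≤ Ewt) :
    ∫ y, ‖S.Sψ t y‖ ≤ (2 * (Real.sqrt Ep * Real.sqrt Er) + Er) + LS + (2 * (Real.sqrt Epc * Real.sqrt Ewt) + Ewt) := by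
  have hD := h.hD
  obtain ⟨hψ0, hψ1⟩ := h.hψ01 t
  have hψ2 : (S.ψ t) ^ 2 ≤ 1 := by nlinarith
  have hψ3 : |(S.ψ t) ^ 3 - (S.ψ t) ^ 2| ≤ 1 := by
    rw [abs_le]; constructor <;> nlinarith [pow_le_one₀ hψ0 hψ1 (n := 3), pow_nonneg hψ0 3]
  have hψ4 : |(S.ψ t) ^ 4 - (S.ψ t) ^ 2| ≤ 1 := by
    rw [abs_le]; constructor <;> nlinarith [pow_le_one₀ hψ0 hψ1 (n := 4), pow_nonneg hψ0 4]
  have hcr : Torus.IsSmooth (S.D.cross t) := Datum.isSmooth_cross hD ht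
  have hso : Torus.IsSmooth (S.D.Sosc t) := Datum.isSmooth_Sosc hD ht
  have hA : Torus.IsSmooth (S.D.wpc t) := (Datum.smooth_wpc hD).isSmooth_slice ht
  have hB : Torus.IsSmooth (wt S.D t) := (smooth_wt h).isSmooth_slice ht
  have hSs : Torus.IsSmooth (S.Sψ t) := (smooth_Sψ h).isSmooth_slice (mem_univ t)
  -- pointwise
  have hpt : ∀ y, ‖S.Sψ t y‖ ≤ ‖S.D.cross t y‖ + ‖S.D.Sosc t y‖ + 2 * (‖S.D.wpc t y‖ * ‖wt S.D t y‖) + ‖wt S.D t y‖ * ‖wt S.D t y‖ := by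
    intro y
    have e : S.Sψ t y = (S.ψ t) ^ 2 • (S.D.cross t y + S.D.Sosc t y) +
        ((S.ψ t) ^ 3 - (S.ψ t) ^ 2) • (Torus.tensorProd (S.D.wpc t) (wt S.D t) y + Torus.tensorProd (wt S.D t) (S.D.wpc t) y) +
        ((S.ψ t) ^ 4 - (S.ψ t) ^ 2) • Torus.tensorProd (wt S.D t) (wt S.D t) y := by
      funext j; simp only [Sψ, Pi.add_apply, Pi.smul_apply]
    rw [e]
    have n1 : ‖(S.ψ t) ^ 2 • (S.D.cross t y + S.D.Sosc t y)‖ ≤ ‖S.D.cross t y‖ + ‖S.D.Sosc t y‖ := by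
      rw [norm_smul, Real.norm_of_nonneg (sq_nonneg _)]
      exact (mul_le_mul hψ2 (norm_add_le _ _) (norm_nonneg _) zero_le_one).trans (by rw [one_mul])
    have n2 : ‖((S.ψ t) ^ 3 - (S.ψ t) ^ 2) • (Torus.tensorProd (S.D.wpc t) (wt S.D t) y + Torus.tensorProd (wt S.D t) (S.D.wpc t) y)‖ ≤
        2 * (‖S.D.wpc t y‖ * ‖wt S.D t y‖) := by
      rw [norm_smul, Real.norm_eq_abs]
      have hb : ‖Torus.tensorProd (S.D.wpc t) (wt S.D t) y + Torus.tensorProd (wt S.D t) (S.D.wpc t) y‖ ≤ 2 * (‖S.D.wpc t y‖ * ‖wt S.D t y‖) :=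
        (norm_add_le _ _).trans (by
          have a1 := norm_tensorProd_le (S.D.wpc t) (wt S.D t) y
          have a2 := norm_tensorProd_le (wt S.D t) (S.D.wpc t) y
          nlinarith)
      exact (mul_le_mul hψ3 hb (norm_nonneg _) zero_le_one).trans (by rw [one_mul])
    have n3 : ‖((S.ψ t) ^ 4 - (S.ψ t) ^ 2) • Torus.tensorProd (wt S.D t) (wt S.D t) y‖ ≤ ‖wt S.D t y‖ * ‖wt S.D t y‖ := by
      rw [norm_smul, Real.norm_eq_abs]
      exact (mul_le_mul hψ4 (norm_tensorProd_le _ _ y) (norm_nonneg _) zero_le_one).trans (by rw [one_mul])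
    exact (norm_add_le _ _).trans (add_le_add ((norm_add_le _ _).trans (add_le_add n1 n2)) n3)
  -- integrate
  have cc : Continuous fun y => ‖S.D.cross t y‖ := hcr.continuous.norm
  have co : Continuous fun y => ‖S.D.Sosc t y‖ := hso.continuous.norm
  have cAB : Continuous fun y => ‖S.D.wpc t y‖ * ‖wt S.D t y‖ := hA.continuous.norm.mul hB.continuous.norm
  have cBB : Continuous fun y => ‖wt S.D t y‖ * ‖wt S.D t y‖ := hB.continuous.norm.mul hB.continuous.norm
  have i12 : Integrable (fun y => ‖S.D.cross t y‖ + ‖S.D.Sosc t y‖) volume := (cc.add co).integrable_unitAddTorus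
  have i123 : Integrable (fun y => ‖S.D.cross t y‖ + ‖S.D.Sosc t y‖ + 2 * (‖S.D.wpc t y‖ * ‖wt S.D t y‖)) volume :=
    ((cc.add co).add (cAB.const_mul 2)).integrable_unitAddTorus
  have imaj : Integrable (fun y => ‖S.D.cross t y‖ + ‖S.D.Sosc t y‖ + 2 * (‖S.D.wpc t y‖ * ‖wt S.D t y‖) + ‖wt S.D t y‖ * ‖wt S.D t y‖) volume :=
    (((cc.add co).add (cAB.const_mul 2)).add cBB).integrable_unitAddTorus
  have hBB : ∫ y, ‖wt S.D t y‖ * ‖wt S.D t y‖ ≤ Ewt := by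
    refine le_trans (le_of_eq (integral_congr_ae (Eventually.of_forall fun y => ?_))) hEwt
    show ‖wt S.D t y‖ * ‖wt S.D t y‖ = ‖wt S.D t y‖ ^ 2; ring
  calc ∫ y, ‖S.Sψ t y‖ ≤ ∫ y, (‖S.D.cross t y‖ + ‖S.D.Sosc t y‖ + 2 * (‖S.D.wpc t y‖ * ‖wt S.D t y‖) + ‖wt S.D t y‖ * ‖wt S.D t y‖) :=
        integral_mono hSs.continuous.norm.integrable_unitAddTorus imaj hpt
    _ = (∫ y, ‖S.D.cross t y‖) + (∫ y, ‖S.D.Sosc t y‖) + 2 * (∫ y, ‖S.D.wpc t y‖ * ‖wt S.D t y‖) + ∫ y, ‖wt S.D t y‖ * ‖wt S.D t y‖ := by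
        rw [integral_add i123 cBB.integrable_unitAddTorus, integral_add i12 (cAB.const_mul 2).integrable_unitAddTorus,
          integral_add cc.integrable_unitAddTorus co.integrable_unitAddTorus, integral_const_mul]
    _ ≤ (2 * (Real.sqrt Ep * Real.sqrt Er) + Er) + LS + 2 * (Real.sqrt Epc * Real.sqrt Ewt) + Ewt :=
        add_le_add (add_le_add (add_le_add (Datum.integral_norm_cross_le hD ht hEp hEr) hS)
          (mul_le_mul_of_nonneg_left (integral_norm_mul_norm_le hA.continuous hB.continuous hEpc hEwt) (by norm_num))) hBB
    _ = _ := by ring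

/-- **`∫‖ℛ f_ψ‖ ≤ 2L_{f₁} + C₁·2(L_{f₂} + L_{f₃}) + Ψ₁ C₁ (L_p + L_c) + 2Ψ₁ C₁ √E_X`**
(`f_ψ = ψ²f + ψ′wpc + (ψ-ψ²)∂ₜwpc + 2ψψ′X`, `f = f₁ + f₂ + f₃ + f₄`, `f₁ = ∂ₜwpc`, `|ψ′| ≤ Ψ₁`).
[cite: LuoTiti2020, §3.5 (3.18)] -/
theorem integral_norm_antidivergence_fψ_le {t : ℝ} (ht : t ∈ Icc 0 S.D.T) {Ψ₁ Lp Lc EX Lf₂ Lf₃ Lf₁ : ℝ} {C₁ : ℝ≥0}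
    (hΨ : |deriv S.ψ t| ≤ Ψ₁) (hLp : ∫ y, ‖S.D.wp t y‖ ≤ Lp) (hLc : ∫ y, ‖S.D.wpc t y - S.D.wp t y‖ ≤ Lc)
    (hEX : ∫ y, ‖S.D.X t y‖ ^ 2 ≤ EX) (hf₂ : ∫ y, ‖S.D.f₂ t y‖ ≤ Lf₂) (hf₃ : ∫ y, ‖S.D.f₃ t y‖ ≤ Lf₃)
    (hf₁ : ∫ y, ‖Torus.antidivergence (S.D.f₁ t) y‖ ≤ Lf₁)
    (hC₁ : ∀ g : 𝕋³ → E³, Torus.IsSmooth g → eLpNorm (Torus.antidivergence g) 1 volume ≤ C₁ * eLpNorm g 1 volume) :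
    ∫ y, ‖Torus.antidivergence (S.fψ t) y‖ ≤
      (Lf₁ + (C₁ : ℝ) * (2 * (Lf₂ + Lf₃))) + Ψ₁ * ((C₁ : ℝ) * (Lp + Lc)) + Lf₁ + 2 * Ψ₁ * ((C₁ : ℝ) * Real.sqrt EX) := by
  have hD := h.hD
  obtain ⟨hψ0, hψ1⟩ := h.hψ01 t
  have hΨ0 : 0 ≤ Ψ₁ := (abs_nonneg _).trans hΨ
  have hψψ : |S.ψ t - (S.ψ t) ^ 2| ≤ 1 := by rw [abs_le]; constructor <;> nlinarith
  have h2ψ : |2 * S.ψ t * deriv S.ψ t| ≤ 2 * Ψ₁ := by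
    rw [abs_mul, abs_mul, abs_of_pos (by norm_num : (0:ℝ) < 2), abs_of_nonneg hψ0]
    nlinarith [abs_nonneg (deriv S.ψ t)]
  -- smoothness
  have hff : Torus.IsSmooth (S.D.ffun t) := (Datum.smooth_ffun hD).isSmooth_slice ht
  have hf1 : Torus.IsSmooth (S.D.f₁ t) := (Datum.smooth_f₁ hD).isSmooth_slice ht
  have hf2 : Torus.IsSmooth (S.D.f₂ t) := (Datum.smooth_f₂ hD).isSmooth_slice ht
  have hf3 : Torus.IsSmooth (S.D.f₃ t) := (Datum.smooth_f₃ hD).isSmooth_slice ht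
  have hwpc : Torus.IsSmooth (S.D.wpc t) := (Datum.smooth_wpc hD).isSmooth_slice ht
  have hwp := Datum.isSmooth_wp hD ht
  have hX : Torus.IsSmooth (S.D.X t) := (Datum.smooth_X hD).isSmooth_slice ht
  have hg : Torus.IsSmooth (fun y => S.D.f₂ t y + S.D.f₃ t y + S.D.f₄ t) := (hf2.add hf3).add (Torus.isSmooth_const _)
  -- `f_ψ = ψ² f + ψ′ wpc + (ψ-ψ²) f₁ + 2ψψ′ X`
  have e : S.fψ t = ((S.ψ t) ^ 2 • S.D.ffun t + deriv S.ψ t • S.D.wpc t) + ((S.ψ t - (S.ψ t) ^ 2) • S.D.f₁ t + (2 * S.ψ t * deriv S.ψ t) • S.D.X t) := by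
    funext y; simp only [fψ, Datum.f₁, Pi.add_apply, Pi.smul_apply]; abel
  have s1 : Torus.IsSmooth ((S.ψ t) ^ 2 • S.D.ffun t) := hff.smul _
  have s2 : Torus.IsSmooth (deriv S.ψ t • S.D.wpc t) := hwpc.smul _
  have s3 : Torus.IsSmooth ((S.ψ t - (S.ψ t) ^ 2) • S.D.f₁ t) := hf1.smul _
  have s4 : Torus.IsSmooth ((2 * S.ψ t * deriv S.ψ t) • S.D.X t) := hX.smul _
  have eR : Torus.antidivergence (S.fψ t) = ((S.ψ t) ^ 2 • Torus.antidivergence (S.D.ffun t) + deriv S.ψ t • Torus.antidivergence (S.D.wpc t)) +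
      ((S.ψ t - (S.ψ t) ^ 2) • Torus.antidivergence (S.D.f₁ t) + (2 * S.ψ t * deriv S.ψ t) • Torus.antidivergence (S.D.X t)) := by
    rw [e, Torus.antidivergence_add (s1.add s2) (s3.add s4), Torus.antidivergence_add s1 s2, Torus.antidivergence_add s3 s4,
      Torus.antidivergence_const_smul hff, Torus.antidivergence_const_smul hwpc, Torus.antidivergence_const_smul hf1,
      Torus.antidivergence_const_smul hX]
  have hAff : Torus.IsSmooth (Torus.antidivergence (S.D.ffun t)) := Torus.isSmooth_antidivergence hff
  have hAw : Torus.IsSmooth (Torus.antidivergence (S.D.wpc t)) := Torus.isSmooth_antidivergence hwpc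
  have hA1 : Torus.IsSmooth (Torus.antidivergence (S.D.f₁ t)) := Torus.isSmooth_antidivergence hf1
  have hAX : Torus.IsSmooth (Torus.antidivergence (S.D.X t)) := Torus.isSmooth_antidivergence hX
  -- pointwise
  have hpt : ∀ y, ‖Torus.antidivergence (S.fψ t) y‖ ≤ ‖Torus.antidivergence (S.D.ffun t) y‖ + Ψ₁ * ‖Torus.antidivergence (S.D.wpc t) y‖ +
      ‖Torus.antidivergence (S.D.f₁ t) y‖ + 2 * Ψ₁ * ‖Torus.antidivergence (S.D.X t) y‖ := by
    intro y
    rw [eR]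
    simp only [Pi.add_apply, Pi.smul_apply]
    have hψ2 : (S.ψ t) ^ 2 ≤ 1 := by nlinarith
    have n1 : ‖(S.ψ t) ^ 2 • Torus.antidivergence (S.D.ffun t) y‖ ≤ ‖Torus.antidivergence (S.D.ffun t) y‖ := by
      rw [norm_smul, Real.norm_of_nonneg (sq_nonneg _)]; exact (mul_le_of_le_one_left (norm_nonneg _) hψ2)
    have n2 : ‖deriv S.ψ t • Torus.antidivergence (S.D.wpc t) y‖ ≤ Ψ₁ * ‖Torus.antidivergence (S.D.wpc t) y‖ := by
      rw [norm_smul, Real.norm_eq_abs]; exact mul_le_mul_of_nonneg_right hΨ (norm_nonneg _)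
    have n3 : ‖(S.ψ t - (S.ψ t) ^ 2) • Torus.antidivergence (S.D.f₁ t) y‖ ≤ ‖Torus.antidivergence (S.D.f₁ t) y‖ := by
      rw [norm_smul, Real.norm_eq_abs]; exact mul_le_of_le_one_left (norm_nonneg _) hψψ
    have n4 : ‖(2 * S.ψ t * deriv S.ψ t) • Torus.antidivergence (S.D.X t) y‖ ≤ 2 * Ψ₁ * ‖Torus.antidivergence (S.D.X t) y‖ := by
      rw [norm_smul, Real.norm_eq_abs]; exact mul_le_mul_of_nonneg_right h2ψ (norm_nonneg _)
    exact (norm_add_le _ _).trans (by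
      have a := norm_add_le ((S.ψ t) ^ 2 • Torus.antidivergence (S.D.ffun t) y) (deriv S.ψ t • Torus.antidivergence (S.D.wpc t) y)
      have b := norm_add_le ((S.ψ t - (S.ψ t) ^ 2) • Torus.antidivergence (S.D.f₁ t) y) ((2 * S.ψ t * deriv S.ψ t) • Torus.antidivergence (S.D.X t) y)
      linarith)
  -- the four integrals
  have bff : ∫ y, ‖Torus.antidivergence (S.D.ffun t) y‖ ≤ Lf₁ + (C₁ : ℝ) * (2 * (Lf₂ + Lf₃)) := by
    have e' : S.D.ffun t = (S.D.f₁ t) + (fun y => S.D.f₂ t y + S.D.f₃ t y + S.D.f₄ t) := by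
      funext y; show S.D.f₁ t y + S.D.f₂ t y + S.D.f₃ t y + S.D.f₄ t = S.D.f₁ t y + (S.D.f₂ t y + S.D.f₃ t y + S.D.f₄ t); abel
    have cA1 : Continuous fun y => ‖Torus.antidivergence (S.D.f₁ t) y‖ := hA1.continuous.norm
    have cA2 : Continuous fun y => ‖Torus.antidivergence (fun y => S.D.f₂ t y + S.D.f₃ t y + S.D.f₄ t) y‖ :=
      (Torus.isSmooth_antidivergence hg).continuous.norm
    have hg1 : ∫ y, ‖S.D.f₂ t y + S.D.f₃ t y + S.D.f₄ t‖ ≤ 2 * (Lf₂ + Lf₃) := by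
      have c2 : Continuous fun y => ‖S.D.f₂ t y‖ := hf2.continuous.norm
      have c3 : Continuous fun y => ‖S.D.f₃ t y‖ := hf3.continuous.norm
      have h4 := Datum.norm_f₄_le hD (smooth_Rc h) ht
      have k23 : Integrable (fun y => ‖S.D.f₂ t y‖ + ‖S.D.f₃ t y‖) volume := (c2.add c3).integrable_unitAddTorus
      have k234 : Integrable (fun y => ‖S.D.f₂ t y‖ + ‖S.D.f₃ t y‖ + ‖S.D.f₄ t‖) volume := ((c2.add c3).add continuous_const).integrable_unitAddTorus
      calc ∫ y, ‖S.D.f₂ t y + S.D.f₃ t y + S.D.f₄ t‖ ≤ ∫ y, (‖S.D.f₂ t y‖ + ‖S.D.f₃ t y‖ + ‖S.D.f₄ t‖) :=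
            integral_mono hg.continuous.norm.integrable_unitAddTorus k234 fun y => (norm_add_le _ _).trans (add_le_add (norm_add_le _ _) le_rfl)
        _ = (∫ y, ‖S.D.f₂ t y‖) + (∫ y, ‖S.D.f₃ t y‖) + ‖S.D.f₄ t‖ := by
            rw [integral_add k23 (integrable_const _), integral_add c2.integrable_unitAddTorus c3.integrable_unitAddTorus]; simp
        _ ≤ Lf₂ + Lf₃ + (Lf₂ + Lf₃) := add_le_add (add_le_add hf₂ hf₃) (h4.trans (add_le_add hf₂ hf₃))
        _ = 2 * (Lf₂ + Lf₃) := by ring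
    have cA : Continuous fun y => ‖Torus.antidivergence (S.D.ffun t) y‖ := hAff.continuous.norm
    rw [e', Torus.antidivergence_add hf1 hg]
    calc ∫ y, ‖(Torus.antidivergence (S.D.f₁ t) + Torus.antidivergence (fun y => S.D.f₂ t y + S.D.f₃ t y + S.D.f₄ t)) y‖
        ≤ ∫ y, (‖Torus.antidivergence (S.D.f₁ t) y‖ + ‖Torus.antidivergence (fun y => S.D.f₂ t y + S.D.f₃ t y + S.D.f₄ t) y‖) :=
          integral_mono (by rw [← Torus.antidivergence_add hf1 hg, ← e']; exact cA.integrable_unitAddTorus) (cA1.add cA2).integrable_unitAddTorus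
            fun y => norm_add_le _ _
      _ ≤ Lf₁ + (C₁ : ℝ) * (2 * (Lf₂ + Lf₃)) := by
          rw [integral_add cA1.integrable_unitAddTorus cA2.integrable_unitAddTorus]
          exact add_le_add hf₁ ((integral_norm_antidivergence_le hC₁ hg).trans (mul_le_mul_of_nonneg_left hg1 C₁.coe_nonneg))
  have bw : ∫ y, ‖Torus.antidivergence (S.D.wpc t) y‖ ≤ (C₁ : ℝ) * (Lp + Lc) := by
    refine (integral_norm_antidivergence_le hC₁ hwpc).trans (mul_le_mul_of_nonneg_left ?_ C₁.coe_nonneg)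
    have c1 : Continuous fun y => ‖S.D.wp t y‖ := hwp.continuous.norm
    have c2 : Continuous fun y => ‖S.D.wpc t y - S.D.wp t y‖ := (hwpc.sub hwp).continuous.norm
    calc ∫ y, ‖S.D.wpc t y‖ ≤ ∫ y, (‖S.D.wp t y‖ + ‖S.D.wpc t y - S.D.wp t y‖) :=
          integral_mono hwpc.continuous.norm.integrable_unitAddTorus (c1.add c2).integrable_unitAddTorus fun y => by
            calc ‖S.D.wpc t y‖ = ‖S.D.wp t y + (S.D.wpc t y - S.D.wp t y)‖ := by congr 1; abel
              _ ≤ _ := norm_add_le _ _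
      _ ≤ Lp + Lc := by rw [integral_add c1.integrable_unitAddTorus c2.integrable_unitAddTorus]; exact add_le_add hLp hLc
  have bX : ∫ y, ‖Torus.antidivergence (S.D.X t) y‖ ≤ (C₁ : ℝ) * Real.sqrt EX :=
    (integral_norm_antidivergence_le hC₁ hX).trans (mul_le_mul_of_nonneg_left (integral_norm_le_sqrt hX.continuous hEX) C₁.coe_nonneg)
  -- integrate the majorant
  have cff := hAff.continuous.norm
  have cw := hAw.continuous.norm
  have c1' := hA1.continuous.norm
  have cX := hAX.continuous.norm
  have i12 : Integrable (fun y => ‖Torus.antidivergence (S.D.ffun t) y‖ + Ψ₁ * ‖Torus.antidivergence (S.D.wpc t) y‖) volume :=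
    (cff.add (cw.const_mul Ψ₁)).integrable_unitAddTorus
  have i123 : Integrable (fun y => ‖Torus.antidivergence (S.D.ffun t) y‖ + Ψ₁ * ‖Torus.antidivergence (S.D.wpc t) y‖ +
      ‖Torus.antidivergence (S.D.f₁ t) y‖) volume := ((cff.add (cw.const_mul Ψ₁)).add c1').integrable_unitAddTorus
  have imaj : Integrable (fun y => ‖Torus.antidivergence (S.D.ffun t) y‖ + Ψ₁ * ‖Torus.antidivergence (S.D.wpc t) y‖ +
      ‖Torus.antidivergence (S.D.f₁ t) y‖ + 2 * Ψ₁ * ‖Torus.antidivergence (S.D.X t) y‖) volume :=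
    (((cff.add (cw.const_mul Ψ₁)).add c1').add (cX.const_mul _)).integrable_unitAddTorus
  have hfs : Torus.IsSmooth (Torus.antidivergence (S.fψ t)) := Torus.isSmooth_antidivergence ((smooth_fψ h).isSmooth_slice (mem_univ t))
  calc ∫ y, ‖Torus.antidivergence (S.fψ t) y‖ ≤ ∫ y, (‖Torus.antidivergence (S.D.ffun t) y‖ + Ψ₁ * ‖Torus.antidivergence (S.D.wpc t) y‖ +
        ‖Torus.antidivergence (S.D.f₁ t) y‖ + 2 * Ψ₁ * ‖Torus.antidivergence (S.D.X t) y‖) :=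
        integral_mono hfs.continuous.norm.integrable_unitAddTorus imaj hpt
    _ = (∫ y, ‖Torus.antidivergence (S.D.ffun t) y‖) + Ψ₁ * (∫ y, ‖Torus.antidivergence (S.D.wpc t) y‖) +
        (∫ y, ‖Torus.antidivergence (S.D.f₁ t) y‖) + 2 * Ψ₁ * ∫ y, ‖Torus.antidivergence (S.D.X t) y‖ := by
        rw [integral_add i123 (cX.const_mul _).integrable_unitAddTorus, integral_add i12 c1'.integrable_unitAddTorus,
          integral_add cff.integrable_unitAddTorus (cw.const_mul Ψ₁).integrable_unitAddTorus, integral_const_mul, integral_const_mul]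
    _ ≤ (Lf₁ + (C₁ : ℝ) * (2 * (Lf₂ + Lf₃))) + Ψ₁ * ((C₁ : ℝ) * (Lp + Lc)) + Lf₁ + 2 * Ψ₁ * ((C₁ : ℝ) * Real.sqrt EX) :=
        add_le_add (add_le_add (add_le_add bff (mul_le_mul_of_nonneg_left bw hΨ0)) hf₁) (mul_le_mul_of_nonneg_left bX (by positivity))

/-- **The `L¹` size of the new stress at time `t`**: with `V₀ ≥ sup‖v(t)‖`, the sizes of the
jet pieces, `|ψ′(t)| ≤ Ψ₁`, the `L¹` bound `C₁` of `ℛ`, and the hyperviscous size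
`Hν ≥ ∫‖ℛ(ν(-Δ)^θ wloc(t))‖`, the new stress `S_ψ + v ⊗ w + w ⊗ v + ℛ(f_ψ + ν(-Δ)^θ wloc)`
(`LuoTitiPerturbationFracNSR.newStress`) satisfies
`∫‖R_new(t)‖ ≤ [2√E_p√E_r + E_r + L_S + 2√E_pc√E_wt + E_wt] + 2V₀(L_p + L_c + √E_X + √E_ζ) + [2L_{f₁} + 2C₁(L_{f₂}+L_{f₃}) + Ψ₁C₁(L_p + L_c) + 2Ψ₁C₁√E_X] + Hν`.
[cite: LuoTiti2020, §3.5 (3.17)–(3.21)] -/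
theorem integral_norm_newStress_le {θ ν : ℝ} (hθ : 0 < θ) {v : ℝ → 𝕋³ → E³} {t : ℝ} (ht : t ∈ Icc 0 S.D.T)
    (hvs : Torus.IsSmooth (v t))
    {V₀ Ep Sc Lc EX Eζ Lp LS Lf₂ Lf₃ Lf₁ Ψ₁ Hν : ℝ} {C₁ : ℝ≥0}
    (hV : ∀ y, ‖v t y‖ ≤ V₀)
    (hEp : ∫ y, ‖S.D.wp t y‖ ^ 2 ≤ Ep) (hLp : ∫ y, ‖S.D.wp t y‖ ≤ Lp)
    (hSc : ∀ y, ‖S.D.wpc t y - S.D.wp t y‖ ≤ Sc) (hLc : ∫ y, ‖S.D.wpc t y - S.D.wp t y‖ ≤ Lc)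
    (hEX : ∫ y, ‖S.D.X t y‖ ^ 2 ≤ EX) (hEζ : ∫ y, ‖Torus.gradient (S.D.zeta t) y‖ ^ 2 ≤ Eζ)
    (hS : ∫ y, ‖S.D.Sosc t y‖ ≤ LS) (hf₂ : ∫ y, ‖S.D.f₂ t y‖ ≤ Lf₂) (hf₃ : ∫ y, ‖S.D.f₃ t y‖ ≤ Lf₃)
    (hf₁ : ∫ y, ‖Torus.antidivergence (S.D.f₁ t) y‖ ≤ Lf₁) (hΨ : |deriv S.ψ t| ≤ Ψ₁)
    (hC₁ : ∀ g : 𝕋³ → E³, Torus.IsSmooth g → eLpNorm (Torus.antidivergence g) 1 volume ≤ C₁ * eLpNorm g 1 volume)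
    (hH : ∫ y, ‖Torus.antidivergence (fun z => ν • Torus.fracLaplacian θ (S.wloc t) z) y‖ ≤ Hν) :
    ∫ y, ‖(fun (y : 𝕋³) (j : Fin 3) => S.Sψ t y j + Torus.tensorProd (v t) (S.w t) y j + Torus.tensorProd (S.w t) (v t) y j +
        Torus.antidivergence (fun z => S.fψ t z + ν • Torus.fracLaplacian θ (S.wloc t) z) y j) y‖ ≤
      ((2 * (Real.sqrt Ep * Real.sqrt (3 * (Sc * Lc + EX + Eζ))) + 3 * (Sc * Lc + EX + Eζ)) + LS +
        (2 * (Real.sqrt (2 * (Ep + Sc * Lc)) * Real.sqrt (2 * (EX + Eζ))) + 2 * (EX + Eζ))) +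
      2 * V₀ * (Lp + Lc + Real.sqrt EX + Real.sqrt Eζ) +
      ((Lf₁ + (C₁ : ℝ) * (2 * (Lf₂ + Lf₃))) + Ψ₁ * ((C₁ : ℝ) * (Lp + Lc)) + Lf₁ + 2 * Ψ₁ * ((C₁ : ℝ) * Real.sqrt EX)) + Hν := by
  have hD := h.hD
  -- smoothness at time `t`
  have hw : Torus.IsSmooth (S.w t) := (smooth_w h).isSmooth_slice (mem_univ t)
  have hwl : Torus.IsSmooth (S.wloc t) := (smooth_wloc h).isSmooth_slice (mem_univ t)
  have hSs : Torus.IsSmooth (S.Sψ t) := (smooth_Sψ h).isSmooth_slice (mem_univ t)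
  have hfs : Torus.IsSmooth (S.fψ t) := (smooth_fψ h).isSmooth_slice (mem_univ t)
  have hΛ : Torus.IsSmooth (fun z => ν • Torus.fracLaplacian θ (S.wloc t) z) := (hwl.fracLaplacian hθ.le).smul ν
  have hAf : Torus.IsSmooth (Torus.antidivergence (S.fψ t)) := Torus.isSmooth_antidivergence hfs
  have hAΛ : Torus.IsSmooth (Torus.antidivergence (fun z => ν • Torus.fracLaplacian θ (S.wloc t) z)) := Torus.isSmooth_antidivergence hΛ
  have hg : Torus.IsSmooth (fun z => S.fψ t z + ν • Torus.fracLaplacian θ (S.wloc t) z) := hfs.add hΛ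
  have hAg : Torus.IsSmooth (Torus.antidivergence (fun z => S.fψ t z + ν • Torus.fracLaplacian θ (S.wloc t) z)) :=
    Torus.isSmooth_antidivergence hg
  set NS : 𝕋³ → Fin 3 → E³ := fun y j => S.Sψ t y j + Torus.tensorProd (v t) (S.w t) y j + Torus.tensorProd (S.w t) (v t) y j +
    Torus.antidivergence (fun z => S.fψ t z + ν • Torus.fracLaplacian θ (S.wloc t) z) y j with hNS
  have hns : Torus.IsSmooth NS := ((hSs.add (hvs.tensorProd hw)).add (hw.tensorProd hvs)).add hAg
  have hV0 : 0 ≤ V₀ := (norm_nonneg _).trans (hV (Classical.arbitrary _))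
  -- pointwise
  have hpt : ∀ y, ‖NS y‖ ≤ ‖S.Sψ t y‖ + 2 * V₀ * ‖S.w t y‖ + ‖Torus.antidivergence (S.fψ t) y‖ +
      ‖Torus.antidivergence (fun z => ν • Torus.fracLaplacian θ (S.wloc t) z) y‖ := by
    intro y
    have e : NS y = S.Sψ t y + Torus.tensorProd (v t) (S.w t) y + Torus.tensorProd (S.w t) (v t) y +
        (Torus.antidivergence (S.fψ t) y + Torus.antidivergence (fun z => ν • Torus.fracLaplacian θ (S.wloc t) z) y) := by
      rw [← Torus.antidivergence_add_apply hfs hΛ y]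
      funext j; simp only [hNS, Pi.add_apply]
    rw [e]
    have t1 : ‖Torus.tensorProd (v t) (S.w t) y‖ ≤ V₀ * ‖S.w t y‖ :=
      (norm_tensorProd_le _ _ y).trans (mul_le_mul_of_nonneg_right (hV y) (norm_nonneg _))
    have t2 : ‖Torus.tensorProd (S.w t) (v t) y‖ ≤ V₀ * ‖S.w t y‖ :=
      (norm_tensorProd_le _ _ y).trans (by rw [mul_comm]; exact mul_le_mul_of_nonneg_right (hV y) (norm_nonneg _))
    calc _ ≤ ‖S.Sψ t y + Torus.tensorProd (v t) (S.w t) y + Torus.tensorProd (S.w t) (v t) y‖ +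
          ‖Torus.antidivergence (S.fψ t) y + Torus.antidivergence (fun z => ν • Torus.fracLaplacian θ (S.wloc t) z) y‖ := norm_add_le _ _
      _ ≤ (‖S.Sψ t y‖ + ‖Torus.tensorProd (v t) (S.w t) y‖ + ‖Torus.tensorProd (S.w t) (v t) y‖) +
          (‖Torus.antidivergence (S.fψ t) y‖ + ‖Torus.antidivergence (fun z => ν • Torus.fracLaplacian θ (S.wloc t) z) y‖) :=
          add_le_add ((norm_add_le _ _).trans (add_le_add (norm_add_le _ _) le_rfl)) (norm_add_le _ _)
      _ ≤ _ := by nlinarith [t1, t2]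
  -- integrate the majorant
  have cS : Continuous fun y => ‖S.Sψ t y‖ := hSs.continuous.norm
  have cw : Continuous fun y => 2 * V₀ * ‖S.w t y‖ := hw.continuous.norm.const_mul _
  have cA : Continuous fun y => ‖Torus.antidivergence (S.fψ t) y‖ := hAf.continuous.norm
  have cB : Continuous fun y => ‖Torus.antidivergence (fun z => ν • Torus.fracLaplacian θ (S.wloc t) z) y‖ := hAΛ.continuous.norm
  have i12 : Integrable (fun y => ‖S.Sψ t y‖ + 2 * V₀ * ‖S.w t y‖) volume := (cS.add cw).integrable_unitAddTorus
  have i123 : Integrable (fun y => ‖S.Sψ t y‖ + 2 * V₀ * ‖S.w t y‖ + ‖Torus.antidivergence (S.fψ t) y‖) volume :=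
    ((cS.add cw).add cA).integrable_unitAddTorus
  have imaj : Integrable (fun y => ‖S.Sψ t y‖ + 2 * V₀ * ‖S.w t y‖ + ‖Torus.antidivergence (S.fψ t) y‖ +
      ‖Torus.antidivergence (fun z => ν • Torus.fracLaplacian θ (S.wloc t) z) y‖) volume := (((cS.add cw).add cA).add cB).integrable_unitAddTorus
  have step1 : ∫ y, ‖NS y‖ ≤ (∫ y, ‖S.Sψ t y‖) + 2 * V₀ * (∫ y, ‖S.w t y‖) + (∫ y, ‖Torus.antidivergence (S.fψ t) y‖) +
      ∫ y, ‖Torus.antidivergence (fun z => ν • Torus.fracLaplacian θ (S.wloc t) z) y‖ := by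
    refine (integral_mono hns.continuous.norm.integrable_unitAddTorus imaj hpt).trans (le_of_eq ?_)
    rw [integral_add i123 cB.integrable_unitAddTorus, integral_add i12 cA.integrable_unitAddTorus,
      integral_add cS.integrable_unitAddTorus cw.integrable_unitAddTorus, integral_const_mul]
  -- the pieces
  have hEr := Datum.integral_norm_wr_sq_le hD ht hSc hLc hEX hEζ
  have bS := integral_norm_Sψ_le h ht hEp hEr hS (integral_norm_wpc_sq_le h ht hEp hSc hLc) (integral_norm_wt_sq_le h ht hEX hEζ)
  have bw := integral_norm_w_le h ht hLp hLc hEX hEζ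
  have bf := integral_norm_antidivergence_fψ_le h ht hΨ hLp hLc hEX hf₂ hf₃ hf₁ hC₁
  have h2V : 0 ≤ 2 * V₀ := by positivity
  have := mul_le_mul_of_nonneg_left bw h2V
  show ∫ y, ‖NS y‖ ≤ _
  linarith [step1]

end Setup

end LuoTiti

end Literature.Analysis.FluidPDE
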